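import Mathlib.CategoryTheory.Monoidal.Cartesian.Over
import Literature.NumberTheory.DiophantineGeometry.AbelianVarietyOrdinaryReduction
import Literature.NumberTheory.DiophantineGeometry.AVGeomPointsDivisibleProofs
import Literature.AlgebraicGeometry.Motives.GoodReductionZariskiProofs
import Literature.AlgebraicGeometry.Motives.AbelianVarietyProjectiveChart
import Literature.AlgebraicGeometry.Motives.GoodReductionSpecialFibreProofs
import HarnessLib

/-!
# The special fibre of an abelian-scheme model is an abelian variety; its `p`-power torsion

For an abelian variety `A` over a number field `K`, a finite place `v` and an abelian-scheme model
`𝒜 → Spec 𝓞_{K,v}` of `A` at `v` (the tree's `IsAbelianSchemeModel A v 𝒜`,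
`Literature/NumberTheory/DiophantineGeometry/AbelianVarietyOrdinaryReduction.lean`: smooth of
relative dimension `dim A`, proper, generic fibre `≅ A` as a group scheme), this file constructs
the **special fibre as an abelian variety over the residue field `κ(v)`** and identifies its
geometric points and `p`-power torsion with the data of `HasGoodOrdinaryReductionAt`:

* `specialFibreFunctor v` — `𝒳 ↦ 𝒳 ×_{𝓞_{K,v}} κ(v)`, Mathlib's `Over.pullback` along
  `Spec κ(v) → Spec 𝓞_{K,v}` (monoidal, so group schemes go to group schemes); on an integral
  model it is the tree's `IntegralModel.reductionAt` (`rfl`);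
* `IsAbelianSchemeModel.specialFibre h : AbelianVariety κ(v)` — proper by base change,
  geometrically reduced because smooth (Stacks 056T, the tree's
  `geometricallyReduced_of_smoothOfRelativeDimension`), geometrically irreducible by Zariski's
  connectedness theorem (EGA IV₃ 15.5.4; the tree's theorem
  `IntegralModel.geometricallyIrreducible_reductionAt_holds` with
  `AbelianVariety.isSmoothProjective_holds`) — Serre–Tate 1968, §1;
* `IsAbelianSchemeModel.specialFibrePointsEquiv h : specialFibreGeomPoints v 𝒜 ≃* 𝒜_v(κ̄(v))` —
  the `𝓞_{K,v}`-morphisms `Spec κ̄(v) → 𝒜` ARE the `κ̄(v)`-points of the special fibre, as groups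
  (adjunction `Over.map ⊣ Over.pullback`, multiplicative since `Over.pullback` is monoidal);
* `IsAbelianSchemeModel.specialFibrePTorsionCard_eq_natCard_geomTorsion` — the count
  `specialFibrePTorsionCard v 𝒜` of `HasGoodOrdinaryReductionAt` is `#𝒜_v[p](κ̄(v))`;
* `IsAbelianSchemeModel.natCard_geomTorsion_specialFibre_pow`,
  `exists_specialFibre_natCard_geomTorsion_pow` — **for good ordinary reduction at `v ∣ p`,
  `#𝒜_v[pⁿ](κ̄(v)) = p^{(dim A) n}` for all `n`** (`𝒜_v(κ̄)` is divisible, Mumford §6 Appl. 2,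
  and `#𝒜_v[p] = p^{dim A}`: the tree's `AbelianVariety.natCard_geomTorsion_pow_of_natCard`,
  Mumford §15), i.e. the hypothesis `hcount` of the assembly
  `exists_ordinaryFiltration_of_reduction`
  (`AbelianVarietyOrdinaryReductionFiltrationProofs.lean`) of the named fact
  `ordinaryReduction_tateModule_filtration`, now available from `HasGoodOrdinaryReductionAt`.

Not here: the reduction map `A(K̄) → 𝒜_v(κ̄(v))` itself and its Galois equivariance (Serre–Tate
1968, §1), the remaining geometric input of that fact.

## References

* [SerreTate1968GoodReduction] J.-P. Serre, J. Tate, *Good reduction of abelian varieties*,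
  Ann. of Math. 88 (1968), §1.
* [MumfordAV1970] D. Mumford, *Abelian Varieties*, §6 Application 2 (p. 64), §15 (p. 147).
* [Hartshorne1977] R. Hartshorne, *Algebraic Geometry*, II.3 (fibres, base extension).

## Design

`specialFibreFunctor` is an `abbrev` for `Over.pullback _` so that Mathlib's scoped instances
`Functor.grpObjObj` (under `open scoped CategoryTheory.Obj`) and `Hom.group` apply verbatim; the
group isomorphism is proved on the raw hom-types first (`homEquiv_mapPullbackAdj_mul`) and
transported by `change` (the `Points` instances are definitional copies).  Mathlib searched:
`Over.mapPullbackAdj`, `Adjunction.homEquiv_unit`, `Functor.map_mul`, `MonObj.comp_mul`,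
`GeometricallyIntegral.of_geometricallyReduced_of_geometricallyIrreducible` (all used).
-/

noncomputable section

open CategoryTheory AlgebraicGeometry IsDedekindDomain IsDedekindDomain.HeightOneSpectrum
open scoped MonObj NumberField CategoryTheory.Obj AddSubgroup
open Literature.AlgebraicGeometry.Motives (AbelianVariety SchemeOver residueAt IntegralModel)

namespace Literature.NumberTheory.DiophantineGeometry

variable {K : Type} [Field K] [NumberField K] (v : HeightOneSpectrum (𝓞 K))

/-- The closed point `Spec κ(v) → Spec 𝓞_{K,v}` (`Spec` of the tree's `residueAt v`). [folklore] -/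
abbrev specResidueField :
    Spec (.of v.asIdeal.ResidueField) ⟶ Spec (.of (valuationSubringAtPrime K v)) :=
  Spec.map (CommRingCat.ofHom (residueAt v))

/-- The **special fibre functor** `𝒳 ↦ 𝒳 ×_{𝓞_{K,v}} κ(v)` from `𝓞_{K,v}`-schemes to
`κ(v)`-schemes: Mathlib's `Over.pullback` along `Spec κ(v) → Spec 𝓞_{K,v}`.  It is monoidal for the
cartesian structures (Mathlib), so special fibres of group schemes are group schemes
(`Functor.grpObjObj`).  On an integral model `𝒳` it is the tree's `IntegralModel.reductionAt`
(`specialFibreFunctor_obj_eq_reductionAt`, by `rfl`). [cite: SerreTate1968GoodReduction, §1] -/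
abbrev specialFibreFunctor :
    SchemeOver (valuationSubringAtPrime K v) ⥤ SchemeOver v.asIdeal.ResidueField :=
  Over.pullback (specResidueField v)

variable {v} in
/-- The special fibre functor agrees with `IntegralModel.reductionAt` (by `rfl`). [folklore] -/
theorem specialFibreFunctor_obj_eq_reductionAt {X : SchemeOver K}
    (𝒳 : IntegralModel (valuationSubringAtPrime K v) K X) :
    (specialFibreFunctor v).obj 𝒳.total = 𝒳.reductionAt := rfl

section AbelianScheme

variable {v} {A : AbelianVariety K} {𝒜 : SchemeOver (valuationSubringAtPrime K v)} [GrpObj 𝒜]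

/-- **The special fibre of an abelian-scheme model is an abelian variety.**  For an
abelian-scheme model `𝒜` of `A` at `v` (`IsAbelianSchemeModel A v 𝒜`: smooth of relative dimension
`dim A`, proper, generic fibre `≅ A`), the special fibre `𝒜_v = 𝒜 ×_{𝓞_{K,v}} κ(v)` with its group
structure (base change) is an abelian variety over `κ(v)`: proper (base change), and geometrically
integral — geometrically reduced because smooth (Stacks 056T, the tree's
`geometricallyReduced_of_smoothOfRelativeDimension`) and geometrically irreducible by Zariski's
connectedness theorem (EGA IV₃ 15.5.4 / Stacks 0E0N; the tree's theorem
`IntegralModel.geometricallyIrreducible_reductionAt_holds`, using that `A` is smooth projective,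
`AbelianVariety.isSmoothProjective_holds`).  Serre–Tate 1968, §1: "`A` has good reduction at `v` …
the special fibre `A_v` is an abelian variety over `k(v)`". [cite: SerreTate1968GoodReduction, §1] -/
def _root_.Literature.NumberTheory.DiophantineGeometry.IsAbelianSchemeModel.specialFibre
    (h : IsAbelianSchemeModel A v 𝒜) : AbelianVariety v.asIdeal.ResidueField where
  X := (specialFibreFunctor v).obj 𝒜
  isProper := by
    haveI := h.isProper
    exact MorphismProperty.baseChange_obj _ _ ‹_›
  geometricallyIntegral := by
    obtain ⟨e, -⟩ := h.exists_iso
    let 𝒳 : IntegralModel (valuationSubringAtPrime K v) K A.X := ⟨𝒜, e⟩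
    haveI : GeometricallyIrreducible ((specialFibreFunctor v).obj 𝒜).hom :=
      𝒳.geometricallyIrreducible_reductionAt_holds
        (Literature.AlgebraicGeometry.Motives.AbelianVariety.isSmoothProjective_holds (A := A))
        ⟨h.smooth, h.isProper⟩
    haveI := h.smooth
    haveI := smoothOfRelativeDimension_isStableUnderBaseChange (n := A.dim)
    haveI : SmoothOfRelativeDimension A.dim ((specialFibreFunctor v).obj 𝒜).hom :=
      MorphismProperty.baseChange_obj _ _ ‹_›
    haveI : GeometricallyReduced ((specialFibreFunctor v).obj 𝒜).hom :=
      Literature.AlgebraicGeometry.Motives.geometricallyReduced_of_smoothOfRelativeDimension _ A.dim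
    exact .of_geometricallyReduced_of_geometricallyIrreducible _

/-- The underlying `κ(v)`-scheme of the special fibre is `𝒜 ×_{𝓞_{K,v}} κ(v)` (by `rfl`). [folklore] -/
theorem _root_.Literature.NumberTheory.DiophantineGeometry.IsAbelianSchemeModel.specialFibre_X
    (h : IsAbelianSchemeModel A v 𝒜) : h.specialFibre.X = (specialFibreFunctor v).obj 𝒜 := rfl


/-! ### The geometric points of the special fibre -/

variable (v) in
/-- The geometric closed point `Spec κ̄(v) → Spec 𝓞_{K,v}` is the image under `Over.map` of the
`κ(v)`-scheme `Spec κ̄(v)` (`toGeomResidueField v = (κ(v) → κ̄(v)) ∘ residueAt v`). [folklore] -/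
def geomClosedPointIso :
    geomClosedPoint v ≅ (Over.map (specResidueField v)).obj
      (Literature.AlgebraicGeometry.Motives.specOver v.asIdeal.ResidueField (geomResidueField v)) :=
  Over.isoMk (Iso.refl _) (by
    change 𝟙 _ ≫ Spec.map _ ≫ Spec.map _ = Spec.map _
    rw [Category.id_comp, ← Spec.map_comp, ← CommRingCat.ofHom_comp]
    rfl)

variable (v) in
omit [GrpObj 𝒜] in
/-- The adjunction bijection `Hom_{𝓞_{K,v}}(U, 𝒳) ≃ Hom_{κ(v)}(U, 𝒳 ×_{𝓞_{K,v}} κ(v))` (for a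
`κ(v)`-scheme `U`, viewed over `𝓞_{K,v}`) is multiplicative for a group scheme `𝒳`: the special
fibre functor is monoidal (Mathlib `Functor.map_mul`) and precomposition with the unit is a
homomorphism (Mathlib `MonObj.comp_mul`). [folklore] -/
theorem homEquiv_mapPullbackAdj_mul (𝒳 : SchemeOver (valuationSubringAtPrime K v)) [GrpObj 𝒳]
    (U : SchemeOver v.asIdeal.ResidueField) (f g : (Over.map (specResidueField v)).obj U ⟶ 𝒳) :
    (Over.mapPullbackAdj (specResidueField v)).homEquiv U 𝒳 (f * g) =
      (Over.mapPullbackAdj (specResidueField v)).homEquiv U 𝒳 f *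
        (Over.mapPullbackAdj (specResidueField v)).homEquiv U 𝒳 g := by
  rw [Adjunction.homEquiv_unit, Adjunction.homEquiv_unit, Adjunction.homEquiv_unit,
    Functor.map_mul]
  exact MonObj.comp_mul _ _ _

/-- **`𝒜_v(κ̄(v)) = Hom_{𝓞_{K,v}}(Spec κ̄(v), 𝒜)` as groups.**  For an abelian-scheme model `𝒜`, the
tree's `specialFibreGeomPoints v 𝒜` (morphisms from the geometric closed point, a group under
Mathlib's `Hom.group`) is isomorphic to the group of `κ̄(v)`-points of the special fibre abelian
variety `𝒜_v`: the adjunction `Over.map ⊣ Over.pullback` (universal property of the fibre product,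
Hartshorne II.3), multiplicative by `homEquiv_mapPullbackAdj_mul`, after the identification
`geomClosedPointIso` (precomposition is a homomorphism, Mathlib `MonObj.comp_mul`). [folklore] -/
def _root_.Literature.NumberTheory.DiophantineGeometry.IsAbelianSchemeModel.specialFibrePointsEquiv
    (h : IsAbelianSchemeModel A v 𝒜) :
    specialFibreGeomPoints v 𝒜 ≃* h.specialFibre.Points (geomResidueField v) :=
  MulEquiv.mk'
    (((geomClosedPointIso v).homCongr (Iso.refl 𝒜)).trans
      ((Over.mapPullbackAdj (specResidueField v)).homEquiv _ 𝒜))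
    (fun P Q ↦ by
      change (Over.mapPullbackAdj (specResidueField v)).homEquiv _ 𝒜
          ((geomClosedPointIso v).inv ≫ (P * Q) ≫ (Iso.refl 𝒜).hom) =
        (Over.mapPullbackAdj (specResidueField v)).homEquiv _ 𝒜
            ((geomClosedPointIso v).inv ≫ P ≫ (Iso.refl 𝒜).hom) *
          (Over.mapPullbackAdj (specResidueField v)).homEquiv _ 𝒜
            ((geomClosedPointIso v).inv ≫ Q ≫ (Iso.refl 𝒜).hom)
      rw [Iso.refl_hom, Category.comp_id, Category.comp_id, Category.comp_id, MonObj.comp_mul]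
      exact homEquiv_mapPullbackAdj_mul v 𝒜 _ _ _)

/-- Unfolding `specialFibrePointsEquiv`: `P ↦` the adjoint (`Over.map ⊣ Over.pullback`) of
`e⁻¹ ≫ P`, `e = geomClosedPointIso v`. [folklore] -/
theorem _root_.Literature.NumberTheory.DiophantineGeometry.IsAbelianSchemeModel.specialFibrePointsEquiv_apply
    (h : IsAbelianSchemeModel A v 𝒜) (P : specialFibreGeomPoints v 𝒜) :
    h.specialFibrePointsEquiv P =
      (Over.mapPullbackAdj (specResidueField v)).homEquiv _ 𝒜 ((geomClosedPointIso v).inv ≫ P) := by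
  change (Over.mapPullbackAdj (specResidueField v)).homEquiv _ 𝒜
    ((geomClosedPointIso v).inv ≫ P ≫ (Iso.refl 𝒜).hom) = _
  rw [Iso.refl_hom, Category.comp_id]

/-- **`#𝒜_v[p](κ̄(v))` computed on the special fibre abelian variety**: the tree's count
`specialFibrePTorsionCard v 𝒜 = #{P ∈ Hom_{𝓞_{K,v}}(Spec κ̄(v), 𝒜) | P ^ p = 1}` (`p = char κ(v)`)
is `#𝒜_v[p](κ̄(v))` for the tree's `AbelianVariety.torsionPoints` of the special fibre (transport
along `specialFibrePointsEquiv`). [folklore] -/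
theorem _root_.Literature.NumberTheory.DiophantineGeometry.IsAbelianSchemeModel.specialFibrePTorsionCard_eq
    (h : IsAbelianSchemeModel A v 𝒜) :
    specialFibrePTorsionCard v 𝒜 =
      Nat.card (h.specialFibre.torsionPoints (geomResidueField v) (residueChar v)) := by
  refine Nat.card_congr (h.specialFibrePointsEquiv.toEquiv.subtypeEquiv fun P ↦ ?_)
  rw [Literature.AlgebraicGeometry.Motives.AbelianVariety.mem_torsionPoints_iff, zpow_natCast,
    MulEquiv.toEquiv_eq_coe, MulEquiv.coe_toEquiv, ← map_pow, MulEquiv.map_eq_one_iff]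

/-- The same count on the additively written geometric points `𝒜_v.geomPoints`
(`AbelianVariety.geomTorsion`, `AVGaloisModule`). [folklore] -/
theorem _root_.Literature.NumberTheory.DiophantineGeometry.IsAbelianSchemeModel.specialFibrePTorsionCard_eq_natCard_geomTorsion
    (h : IsAbelianSchemeModel A v 𝒜) :
    specialFibrePTorsionCard v 𝒜 = Nat.card (h.specialFibre.geomTorsion (residueChar v)) := by
  rw [h.specialFibrePTorsionCard_eq, Nat.card_congr (h.specialFibre.geomTorsionEquiv _)]

/-! ### Ordinary reduction: `#𝒜_v[pⁿ](κ̄(v)) = p^{gn}` -/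

variable (v) in
omit [NumberField K] [GrpObj 𝒜] in
/-- `char κ(v) = p` for a finite place `v` above the rational prime `p` (`p ∈ v`). [folklore] -/
theorem residueChar_eq_of_mem {p : ℕ} (hp : p.Prime) (hpv : ((p : ℕ) : 𝓞 K) ∈ v.asIdeal) :
    residueChar v = p := by
  have h : algebraMap (𝓞 K) v.asIdeal.ResidueField p = 0 :=
    Ideal.algebraMap_residueField_eq_zero.mpr hpv
  rw [map_natCast] at h
  exact CharP.ringChar_of_prime_eq_zero hp h

/-- **Ordinary reduction, all levels: `#𝒜_v[pⁿ](κ̄(v)) = p^{(dim A) n}`.**  If the abelian-scheme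
model `𝒜` of `A` at `v ∣ p` has `#𝒜_v[p](κ̄(v)) = p^{dim A}` (the count of
`HasGoodOrdinaryReductionAt`), then `#𝒜_v[pⁿ](κ̄(v)) = p^{(dim A) n}` for every `n`: the special
fibre is an abelian variety, so `𝒜_v(κ̄)` is divisible (Mumford §6, Application 2) and the
`p`-rank count applies (Mumford §15, p. 147; the tree's
`AbelianVariety.natCard_geomTorsion_pow_of_natCard`). [cite: MumfordAV1970, §15 p. 147 (the p-rank)] -/
theorem _root_.Literature.NumberTheory.DiophantineGeometry.IsAbelianSchemeModel.natCard_geomTorsion_specialFibre_pow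
    (h : IsAbelianSchemeModel A v 𝒜) {p : ℕ} [Fact p.Prime] (hpv : ((p : ℕ) : 𝓞 K) ∈ v.asIdeal)
    (hord : specialFibrePTorsionCard v 𝒜 = residueChar v ^ A.dim) (n : ℕ) :
    Nat.card (h.specialFibre.geomTorsion (p ^ n : ℕ)) = p ^ (A.dim * n) := by
  have hp : residueChar v = p := residueChar_eq_of_mem v Fact.out hpv
  have h1 : Nat.card (h.specialFibre.geomTorsion (p : ℕ)) = p ^ A.dim := by
    rw [← hp, ← h.specialFibrePTorsionCard_eq_natCard_geomTorsion, hord]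
  exact h.specialFibre.natCard_geomTorsion_pow_of_natCard p h1 n

variable (v A) in
omit [GrpObj 𝒜] in
/-- **Good ordinary reduction at `v ∣ p` yields a model whose special fibre abelian variety `𝒜_v`
has `#𝒜_v[pⁿ](κ̄(v)) = p^{(dim A) n}` for all `n`** — the hypothesis `hcount` of
`exists_ordinaryFiltration_of_reduction` (`AbelianVarietyOrdinaryReductionFiltrationProofs`),
produced from the tree's `HasGoodOrdinaryReductionAt`. [cite: MumfordAV1970, §15 p. 147 (the p-rank)] -/
theorem exists_specialFibre_natCard_geomTorsion_pow {p : ℕ} [Fact p.Prime]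
    (hpv : ((p : ℕ) : 𝓞 K) ∈ v.asIdeal) (hA : A.HasGoodOrdinaryReductionAt v) :
    ∃ (𝒜' : SchemeOver (valuationSubringAtPrime K v)) (_ : GrpObj 𝒜')
      (h : IsAbelianSchemeModel A v 𝒜'),
      ∀ n : ℕ, Nat.card (h.specialFibre.geomTorsion (p ^ n : ℕ)) = p ^ (A.dim * n) := by
  obtain ⟨𝒜', inst, h, hord⟩ := hA
  exact ⟨𝒜', inst, h, fun n ↦ h.natCard_geomTorsion_specialFibre_pow hpv hord n⟩

end AbelianScheme

end Literature.NumberTheory.DiophantineGeometry
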